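import Summits.NavierStokesRegularity.NavierStokesRegularity.Theses.AxisymmetricExtremality
import Literature.Analysis.FluidPDE.RusinSverakSingularPoint
import Literature.Analysis.FluidPDE.AxisymmetricTypeIBounded
import HarnessLib.Audit

/-!
# Birth skeleton (BC3) of the crux `AxisymmetricExtremality.AxisymmetricKatoGlobal`

(crux item `stmt-NavierStokesRegularity-15453`, rank 3, route
`route-NavierStokesRegularity-AxisymmetricExtremality`; tree path
`Cruxes/AxisymmetricKatoGlobal/Lines/birth.lean`; registrar
`planner-skel-stmt-NavierStokesRegularity-15453-0`, 2026-08-17. The route predates the Lean birth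
certificate; this file supplies BC3 retroactively.)

THE CRUX (fixed, the route's decl): for every `ν > 0`, every `L³` field `u₀` represented in
`Ḣ^{1/2}`, weakly divergence free and axisymmetric about the `x₂`-axis (rotation-equivariance
written out; definitionally `IsAxisymmetric u₀`) has a global Kato (`C([0,∞); L³)` mild) solution —
axisymmetric-WITH-swirl global regularity in the critical class.

THE CUT — "blow-up ⇒ an axis-localised singular point ⇒ killed by the swirl's continuity at the
axis".  The one scalar structure the axisymmetric class owns is the swirl `Γ = x₀u₁ − x₁u₀ = r u_θ`
(`swirl`), which solves the drift–diffusion equation `∂ₜΓ + u·∇Γ = ν(ΔΓ − (2/r)∂ᵣΓ)`, obeys a maximum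
principle, is SCALE-INVARIANT under the Navier–Stokes scaling, and vanishes on the axis.  Every
positive result on axisymmetric flows with swirl is a statement that a modulus of continuity of `Γ`
AT THE AXIS forces regularity (Lei–Zhang 2017 Cor. 1.3, `|Γ| ≤ C₁|ln r|⁻²`; Wei 2016 Cor. 1.1,
`|ln r|^{-3/2}`; Seregin, J. Math. Fluid Mech. 24 (2022) = arXiv:2201.00153, Thm. 1.2 with §2: the
LOCAL version for suitable weak solutions, driven by `|Γ| ≤ cC₁/ln³(e/r)`), and every blow-up
scenario (Hou, arXiv:2107.06509) keeps `Γ = O(1)` on the collapsing scale.  So the crux is cut into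

* `stub_katoAxisymSingularPoint` [M, KNOWN modulo tree facts] — Kato's `L³` theory in the
  axisymmetric class: if an axisymmetric weakly divergence-free `u₀ ∈ L³` has NO global Kato
  solution, then for some finite `T > 0` (namely `T_max(u₀)`) there is a Kato solution `u` on
  `[0, T)` (`IsKatoSolutionOn`) which is smooth on `(0, T) × ℝ³`, has axisymmetric slices for
  `0 < t < T`, and has a SINGULAR POINT `(T, x_*)`: `‖u‖_{L^∞(Q_r(T, x_*))} = ∞` for every `r > 0`
  (tree: `exists_singularPoint_katoMaximalTime` from `kato_local`,
  `IsKatoSolutionOn.continuation_of_bounded`, `IsKatoSolutionOn.farField_bound`; smoothing of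
  `C_t L³` mild solutions (Kato 1984, `MildL3Smooth`); axisymmetry propagates by rotation covariance
  of the equations + uniqueness `kato_unique_holds` + continuity of the smooth slices).
* `stub_logSwirlRegularity` [L, KNOWN IN ESSENCE — Seregin 2022 §2 Steps 2–4 (local, at axis
  points) + Caffarelli–Kohn–Nirenberg partial regularity with rotation invariance (off the axis),
  both to be run for Kato solutions, which are locally suitable after the Calderón/Rusin–Šverák
  splitting `u = e^{νtΔ}u₀ + w`, `w` of finite energy] — the REGULARITY CRITERION: an
  axisymmetric Kato solution on `[0, T)`, smooth on `(0, T) × ℝ³`, whose swirl satisfies the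
  logarithmic axis modulus `|Γ(t, x)| ≤ C / |log r|³` for `r = cylRadius x ≤ δ₀ < 1` uniformly in
  `t ∈ [t₀, T)`, is bounded near `(T, x₀)` for EVERY `x₀` (`IsBoundedNearTop`).
* `stub_swirlAxisModulus` [XL, OPEN — the load-bearing bet, = the crux's whole difficulty in
  a-priori form] — for an axisymmetric Kato solution on `[0, T)` from a datum represented in
  `Ḣ^{1/2}`, smooth on `(0, T) × ℝ³`, the swirl has that logarithmic modulus at the axis uniformly
  on every `[t₀, T)`, `0 < t₀ < T` (for `T < T_max` this is trivial from `|Γ| ≤ r‖u(t)‖_∞`; the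
  content is `T = T_max`).  Why it might fail: any blow-up with a non-trivial swirl profile on the
  collapsing scale (Hou's two-scale tornado) violates it; known only under Type-I / form-bounded
  control (Lei–Zhang 2011 Thm. 1.1, Seregin 2020) where `Γ` is even Hölder at the axis.

`AxisymmetricKatoGlobal_of : AxisymmetricKatoGlobal` (the ONLY theorem of this file concluding the
crux; conclusion = the crux BY NAME, no `Prop` hypotheses, placeholders only inside the three
declared stubs, which it uses by name) is the real composition: by contradiction, singular point
from stub 1, modulus on `[T/2, T)` from stub 3, local bound at `x_*` from stub 2, and the
measure-theoretic conversion "pointwise bound on the backward cylinder ⇒ finite `L^∞` norm of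
`uncurry u` on `parabolicCylinder r (T, x_*)`", contradicting `= ∞`.  Its CLOSED twin
`AxisymmetricKatoGlobal_of_hyps : <sig 1> → <sig 2> → <sig 3> → AxisymmetricKatoGlobal` (same proof,
the stub statements as hypotheses, no placeholder anywhere) is the registrar's evidence file
`bc/AxisymmetricKatoGlobal_birth_closed.lean` attached to the crux item.

Disproof used: none exists yet for this crux (`ledger crux ls`: no `Disproof.lean`, no dead lines);
negatives index (`ledger negatives --problem NavierStokesRegularity`, 4 entries) — no stub is an
instance of a refuted statement (none concerns swirl moduli, Kato solutions or axisymmetric data).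
Nearest in-tree statements deliberately NOT restated as stubs: `SwirlThreshold.SmallSwirlRegularity`
(ABSOLUTE small-swirl constant, flagged possibly false by its own route) — the criterion here is a
MODULUS at the axis, the printed (relative/local) form; `Literature…LeiZhang2017_logModulus_regularity`
/ `Wei2016_logModulus_regularity` (finite-energy classical solutions from rapidly decaying data) —
the stub is their Kato-class, local-in-`x₀` version, which is what the crux needs.
-/

noncomputable section

open Set MeasureTheory Filter Topology Function Metric
open scoped ENNReal NNReal
open Literature.Analysis.FluidPDE Literature.Analysis.FunctionSpaces

namespace Summit.NavierStokesRegularity.NavierStokesRegularity.Cruxes.AxisymmetricKatoGlobal.Birth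

set_option linter.unusedVariables false
set_option linter.dupNamespace false

local notation "ℝ³" => EuclideanSpace ℝ (Fin 3)

/-- **stub 1 — `stub_katoAxisymSingularPoint` (M; known modulo the tree's Kato facts).**
Kato's `L³` theory in the axisymmetric class: no global Kato solution ⇒ a finite-time Kato solution
which is smooth and axisymmetric inside and has a singular point `(T, x_*)`
(`‖u‖_{L^∞(Q_r(T,x_*))} = ∞` for all `r > 0`; `Q_r(T,x_*) = (T − r², T) × B_r(x_*)` is the tree's
`parabolicCylinder`).  Sources: Kato 1984 Thms 1–4; Lemarié-Rieusset 2016 Thm. 15.1 (C);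
Rusin–Šverák arXiv:0911.0500 §4; tree `exists_singularPoint_katoMaximalTime`, `MildL3Smooth`,
`kato_unique_holds`, `IsClassicalNSSolutionOn.isAxisymmetric_of_data`. -/
theorem stub_katoAxisymSingularPoint :
    ∀ ν : ℝ, 0 < ν → ∀ u₀ : ℝ³ → ℝ³, MemLp u₀ 3 volume → IsWeaklyDivFree u₀ → IsAxisymmetric u₀ →
      ¬ HasGlobalKatoSolution ν u₀ →
      ∃ T : ℝ, 0 < T ∧ ∃ (xs : ℝ³) (u : ℝ → ℝ³ → ℝ³), IsKatoSolutionOn T ν u₀ u ∧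
        ContDiffOn ℝ (⊤ : ℕ∞) (uncurry u) (Ioo 0 T ×ˢ univ) ∧
        (∀ t ∈ Ioo 0 T, IsAxisymmetric (u t)) ∧
        ∀ r : ℝ, 0 < r → eLpNorm (uncurry u) ∞ (volume.restrict (parabolicCylinder r (T, xs))) = ∞ := by
  sorry

/-- **stub 2 — `stub_logSwirlRegularity` (L; the regularity criterion, known in essence:
Seregin arXiv:2201.00153 Thm. 1.2 / §2 at axis points, CKN + rotation invariance off the axis,
run in the Kato class).**  An axisymmetric Kato solution on `[0, T)`, smooth on `(0,T) × ℝ³`, whose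
swirl `Γ = swirl (u t)` obeys `|Γ(t,x)| ≤ C / |log (cylRadius x)|³` for `cylRadius x ≤ δ₀ < 1`,
uniformly in `t ∈ [t₀, T)`, is bounded near `(T, x₀)` for every `x₀` (`IsBoundedNearTop`).  On the
axis the bound reads `|Γ| ≤ C/0 = 0`, which holds because `swirl` vanishes there
(`swirl_eq_zero_of_cylRadius_eq_zero`), so the hypothesis is not vacuous-making. -/
theorem stub_logSwirlRegularity :
    ∀ ν : ℝ, 0 < ν → ∀ T : ℝ, 0 < T → ∀ (u₀ : ℝ³ → ℝ³) (u : ℝ → ℝ³ → ℝ³),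
      IsKatoSolutionOn T ν u₀ u → ContDiffOn ℝ (⊤ : ℕ∞) (uncurry u) (Ioo 0 T ×ˢ univ) →
      (∀ t ∈ Ioo 0 T, IsAxisymmetric (u t)) →
      (∃ t₀ ∈ Ioo 0 T, ∃ C δ₀ : ℝ, 0 < δ₀ ∧ δ₀ < 1 ∧
          ∀ t ∈ Ico t₀ T, ∀ x : ℝ³, cylRadius x ≤ δ₀ →
            |swirl (u t) x| ≤ C / |Real.log (cylRadius x)| ^ 3) →
      ∀ x₀ : ℝ³, IsBoundedNearTop u T x₀ := by
  sorry

/-- **stub 3 — `stub_swirlAxisModulus` (XL; OPEN — the load-bearing a-priori estimate).**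
For an axisymmetric Kato solution on `[0, T)` from an `L³` datum represented in `Ḣ^{1/2}`, smooth on
`(0,T) × ℝ³`: on every `[t₀, T)`, `0 < t₀ < T`, the swirl has the logarithmic modulus
`|Γ(t,x)| ≤ C / |log r|³` at the axis (`r = cylRadius x ≤ δ₀`).  Trivial for `T < T_max(u₀)`; the
content is the maximal time.  Refuted by any blow-up with non-trivial swirl on the collapsing
scale; known under Type-I / form-boundedness control (Lei–Zhang 2011 Thm. 1.1, Seregin 2020/2022). -/
theorem stub_swirlAxisModulus :
    ∀ ν : ℝ, 0 < ν → ∀ T : ℝ, 0 < T → ∀ (u₀ : ℝ³ → ℝ³)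
      (g : HomSobolev ℝ³ (EuclideanSpace ℂ (Fin 3)) (1 / 2 : ℝ)) (u : ℝ → ℝ³ → ℝ³),
      g.Represents (Literature.Analysis.FunctionSpaces.EuclideanSpace.complexify ∘ u₀) →
      IsKatoSolutionOn T ν u₀ u → ContDiffOn ℝ (⊤ : ℕ∞) (uncurry u) (Ioo 0 T ×ˢ univ) →
      (∀ t ∈ Ioo 0 T, IsAxisymmetric (u t)) →
      ∀ t₀ ∈ Ioo 0 T, ∃ C δ₀ : ℝ, 0 < δ₀ ∧ δ₀ < 1 ∧
        ∀ t ∈ Ico t₀ T, ∀ x : ℝ³, cylRadius x ≤ δ₀ →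
          |swirl (u t) x| ≤ C / |Real.log (cylRadius x)| ^ 3 := by
  sorry

/-- A pointwise bound on the backward cylinder `(T − r², T) × B_r(x_*)` makes the `L^∞` norm of
`uncurry u` on the tree's `parabolicCylinder r (T, x_*)` finite (support lemma of the composition). -/
theorem eLpNorm_parabolicCylinder_lt_top_of_bound {u : ℝ → ℝ³ → ℝ³} {T r K : ℝ} {xs : ℝ³}
    (h : ∀ t ∈ Ioo (T - r ^ 2) T, ∀ x ∈ ball xs r, ‖u t x‖ ≤ K) :
    eLpNorm (uncurry u) ∞ (volume.restrict (parabolicCylinder r (T, xs))) < ∞ := by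
  have hmeas : MeasurableSet (parabolicCylinder r ((T, xs) : ℝ × ℝ³)) := by
    unfold parabolicCylinder
    exact measurableSet_Ioo.prod measurableSet_ball
  have hbound : ∀ᵐ z ∂(volume.restrict (parabolicCylinder r ((T, xs) : ℝ × ℝ³))), ‖uncurry u z‖ ≤ K := by
    filter_upwards [ae_restrict_mem hmeas] with z hz
    obtain ⟨ht, hx⟩ := mem_prod.1 hz
    exact h z.1 ht z.2 hx
  rw [eLpNorm_exponent_top]
  exact (eLpNormEssSup_le_of_ae_bound hbound).trans_lt ENNReal.ofReal_lt_top

/-- **Birth composition (the skeleton theorem).** The crux BY NAME from the three registered stubs,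
used by name: by contradiction — singular point (stub 1), axis modulus on `[T/2, T)` (stub 3), local
boundedness at the singular point (stub 2), finiteness of the `L^∞` norm on a backward cylinder. -/
theorem AxisymmetricKatoGlobal_of : Theses.AxisymmetricExtremality.AxisymmetricKatoGlobal := by
  have h1 := stub_katoAxisymSingularPoint
  have h2 := stub_logSwirlRegularity
  have h3 := stub_swirlAxisModulus
  intro ν hν u₀ g hL3 hrep hdiv hax
  -- the written-out rotation-equivariance of the crux is `IsAxisymmetric u₀` definitionally
  have hax' : IsAxisymmetric u₀ := fun θ x => hax θ x
  by_contra hng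
  -- stub 1: a finite-time Kato solution, smooth and axisymmetric inside, singular at `(T, xs)`
  obtain ⟨T, hT, xs, u, hK, hsm, haxi, hsing⟩ := h1 ν hν u₀ hL3 hdiv hax' hng
  -- stub 3: the logarithmic modulus of the swirl at the axis on `[T/2, T)`
  have ht₀ : T / 2 ∈ Ioo 0 T := ⟨by linarith, by linarith⟩
  obtain ⟨C, δ₀, hδ₀, hδ₁, hmod⟩ := h3 ν hν T hT u₀ g u hrep hK hsm haxi (T / 2) ht₀
  -- stub 2: hence every point, in particular `xs`, is bounded near the final time
  obtain ⟨r, hr, K, hbd⟩ := h2 ν hν T hT u₀ u hK hsm haxi ⟨T / 2, ht₀, C, δ₀, hδ₀, hδ₁, hmod⟩ xs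
  -- contradiction with the singularity of `(T, xs)` at radius `r`
  exact absurd (hsing r hr) (eLpNorm_parabolicCylinder_lt_top_of_bound hbd).ne

end Summit.NavierStokesRegularity.NavierStokesRegularity.Cruxes.AxisymmetricKatoGlobal.Birth
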